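import Mathlib
import Summits.MatrixMultiplication.MatrixMultiplication.Theses.SnSubsetDichotomy

/-!
# Strategist sketch 2 — crux `SnSubsetDichotomy.ThresholdSubsetTriples` (stmt-MatrixMultiplication-10882)

Crux-strategist seat `planner-cstrat-stmt-MatrixMultiplication-10882-s1-0`, 2026-08-17 (re-arm after the cone
change: `HyperoctahedralThreshold` refuted / `HyperoctahedralSubsets` proved).  Companion of
`STRATEGY-CENSUS.md` (v2).  Everything here is sorry-free; nothing here is a line or a stub.

* §1 THE ABELIAN SHADOW OF THE TPP (census § Strengthen S2′ / § Negation N2′).  `prod_ne_one_of_movedByOne`: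
  a product `q₁ q₂ q₃` of three permutations is never `1` if some point is moved by EXACTLY ONE of them.  Hence
  the SUPPORT CRITERION `tpp_of_supportSeparated`: if every non-trivial triple of quotients
  `(s s'⁻¹, t t'⁻¹, u u'⁻¹)` has a point moved by exactly one of them, `(S, T, U)` has the TPP.  This is the
  mechanism of CKSU 2005 Prop. 3.? (strong USP ⇒ TPP, arXiv:math/0511460 p. 6: "exactly one of these three
  conditions holds, in which case the equation cannot hold") and of every valuation / peeling argument; its
  ultrametric special case (`tpp_of_levelSeparated`): if the FIRST moved points of the non-trivial quotients of
  `S`, `T`, `U` fall in three pairwise disjoint level sets, the TPP is automatic.  Level-separated designs have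
  volume `≤ ∏ levels = n!` (each level is branched on by one set only), i.e. the abelian bound: the whole
  `(n!)^{1/2}` surplus a threshold witness needs must come from levels SHARED non-commutatively.
* §2 STRENGTHENINGS typed for the census: `SmallDoublingThreshold` (approximate-group witnesses, S1′) with its
  trivial edge to the crux.
* §3 THE HOSTED NEGATIVE (census § Transfer T1′ / § Negation N1′): `HostedWindowSubthreshold`, the statement that
  every TPP triple hosted in three window-sized subgroups is sub-threshold — the common generalisation of the
  new tree theorem `hyperoctahedralSubsets_proof` (hosts `C(μᵢ)`), the Young barrier and the wreath/cell count
  of census v1 T1; conjecture-grade, recorded for the negative team (8302) and the barrier harvest, not claimed.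
-/

set_option linter.dupNamespace false
set_option linter.unusedVariables false

namespace Summit.MatrixMultiplication.MatrixMultiplication.Cruxes.ThresholdSubsetTriples.Strategist2

open scoped BigOperators Pointwise
open Literature.Combinatorics.Additive
open Summit.MatrixMultiplication.MatrixMultiplication.Theses.SnSubsetDichotomy

/-! ## §1 The abelian shadow: support criterion and level separation -/

section Support

variable {α : Type*}

/-- `x` is moved by exactly one of `q₁, q₂, q₃`. -/
def MovedByOne (q₁ q₂ q₃ : Equiv.Perm α) (x : α) : Prop :=
  (q₁ x ≠ x ∧ q₂ x = x ∧ q₃ x = x) ∨ (q₁ x = x ∧ q₂ x ≠ x ∧ q₃ x = x) ∨ (q₁ x = x ∧ q₂ x = x ∧ q₃ x ≠ x)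

/-- **Support lemma.**  If some point is moved by exactly one of `q₁, q₂, q₃` then `q₁ q₂ q₃ ≠ 1`. [folklore] -/
theorem prod_ne_one_of_movedByOne (q₁ q₂ q₃ : Equiv.Perm α) (x : α) (h : MovedByOne q₁ q₂ q₃ x) :
    q₁ * q₂ * q₃ ≠ 1 := by
  intro heq
  have hx : q₁ (q₂ (q₃ x)) = x := by
    have := Equiv.ext_iff.1 heq x
    simpa [Equiv.Perm.mul_apply] using this
  rcases h with ⟨h1, h2, h3⟩ | ⟨h1, h2, h3⟩ | ⟨h1, h2, h3⟩
  · rw [h3, h2] at hx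
    exact h1 hx
  · rw [h3] at hx
    have : q₂ x = x := q₁.injective (hx.trans h1.symm)
    exact h2 this
  · have e1 : q₂ (q₃ x) = x := q₁.injective (hx.trans h1.symm)
    have e2 : q₃ x = x := q₂.injective (e1.trans h2.symm)
    exact h3 e2

/-- A triple is SUPPORT-SEPARATED if every non-trivial triple of quotients has a point moved by exactly one of
the three quotients. -/
def SupportSeparated (S T U : Finset (Equiv.Perm α)) : Prop :=
  ∀ s ∈ S, ∀ s' ∈ S, ∀ t ∈ T, ∀ t' ∈ T, ∀ u ∈ U, ∀ u' ∈ U, ¬ (s = s' ∧ t = t' ∧ u = u') →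
    ∃ x, MovedByOne (s * s'⁻¹) (t * t'⁻¹) (u * u'⁻¹) x

/-- **Support criterion.**  Support-separated triples have the triple product property. [folklore] -/
theorem tpp_of_supportSeparated [DecidableEq α] {S T U : Finset (Equiv.Perm α)}
    (h : SupportSeparated S T U) : TripleProductProperty S T U := by
  intro s hs s' hs' t ht t' ht' u hu u' hu' heq
  by_contra hne
  obtain ⟨x, hx⟩ := h s hs s' hs' t ht t' ht' u hu u' hu' hne
  exact prod_ne_one_of_movedByOne _ _ _ x hx heq

end Support

section Level

variable {n : ℕ}

/-- The set of points moved by `q`. -/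
def moved (q : Equiv.Perm (Fin n)) : Finset (Fin n) := Finset.univ.filter fun x => q x ≠ x

theorem mem_moved {q : Equiv.Perm (Fin n)} {x : Fin n} : x ∈ moved q ↔ q x ≠ x := by
  simp [moved]

theorem moved_nonempty_of_ne_one {q : Equiv.Perm (Fin n)} (hq : q ≠ 1) : (moved q).Nonempty := by
  by_contra h
  rw [Finset.not_nonempty_iff_eq_empty] at h
  apply hq
  refine Equiv.ext fun x => ?_
  have hx : x ∉ moved q := by rw [h]; exact Finset.notMem_empty x
  rw [mem_moved, not_not] at hx
  rw [hx]
  rfl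

/-- The LEVEL (first moved point) of a non-trivial permutation, as a function defined on all permutations
(junk value for `1` is never used: all statements guard with `q ≠ 1`). -/
noncomputable def level (q : Equiv.Perm (Fin n)) : Option (Fin n) :=
  if h : (moved q).Nonempty then some ((moved q).min' h) else none

theorem level_of_ne_one {q : Equiv.Perm (Fin n)} (hq : q ≠ 1) :
    level q = some ((moved q).min' (moved_nonempty_of_ne_one hq)) := by
  simp [level, moved_nonempty_of_ne_one hq]

theorem apply_ne_of_level {q : Equiv.Perm (Fin n)} (hq : q ≠ 1) :
    q ((moved q).min' (moved_nonempty_of_ne_one hq)) ≠ (moved q).min' (moved_nonempty_of_ne_one hq) :=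
  mem_moved.1 (Finset.min'_mem _ _)

theorem apply_eq_of_lt_level {q : Equiv.Perm (Fin n)} (hq : q ≠ 1) {x : Fin n}
    (hx : x < (moved q).min' (moved_nonempty_of_ne_one hq)) : q x = x := by
  by_contra h
  have hmem : x ∈ moved q := mem_moved.2 h
  exact absurd (Finset.min'_le _ _ hmem) (not_le.2 hx)

/-- A triple is LEVEL-SEPARATED by three level sets `V 0, V 1, V 2 ⊆ Fin n` (pairwise disjoint) if the first
moved point of every non-trivial quotient of the `i`-th set lies in `V i`. -/
def LevelSeparated (V : Fin 3 → Finset (Fin n)) (S T U : Finset (Equiv.Perm (Fin n))) : Prop :=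
  (∀ i j, i ≠ j → Disjoint (V i) (V j)) ∧
  (∀ s ∈ S, ∀ s' ∈ S, ∀ h : s * s'⁻¹ ≠ 1, (moved (s * s'⁻¹)).min' (moved_nonempty_of_ne_one h) ∈ V 0) ∧
  (∀ t ∈ T, ∀ t' ∈ T, ∀ h : t * t'⁻¹ ≠ 1, (moved (t * t'⁻¹)).min' (moved_nonempty_of_ne_one h) ∈ V 1) ∧
  (∀ u ∈ U, ∀ u' ∈ U, ∀ h : u * u'⁻¹ ≠ 1, (moved (u * u'⁻¹)).min' (moved_nonempty_of_ne_one h) ∈ V 2)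

/-- Core of the ultrametric argument: three permutations whose levels (when non-trivial) lie in pairwise
disjoint sets, not all trivial, have a point moved by exactly one of them — the smallest level. -/
theorem movedByOne_of_levels (V : Fin 3 → Finset (Fin n)) (hV : ∀ i j, i ≠ j → Disjoint (V i) (V j))
    (q : Fin 3 → Equiv.Perm (Fin n))
    (hq : ∀ i, ∀ h : q i ≠ 1, (moved (q i)).min' (moved_nonempty_of_ne_one h) ∈ V i)
    (hne : ∃ i, q i ≠ 1) : ∃ x, MovedByOne (q 0) (q 1) (q 2) x := by
  classical
  -- the set of all moved points of the three permutations is non-empty; take its minimum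
  set M : Finset (Fin n) := moved (q 0) ∪ moved (q 1) ∪ moved (q 2) with hM
  obtain ⟨i₀, hi₀⟩ := hne
  have hMne : M.Nonempty := by
    obtain ⟨y, hy⟩ := moved_nonempty_of_ne_one hi₀
    refine ⟨y, ?_⟩
    fin_cases i₀ <;> simp_all
  set m := M.min' hMne with hm
  have hmM : m ∈ M := Finset.min'_mem _ _
  -- whichever permutation moves `m` has level exactly `m`
  have key : ∀ i, q i m ≠ m → ∀ h : q i ≠ 1, (moved (q i)).min' (moved_nonempty_of_ne_one h) = m := by
    intro i hmi h
    apply le_antisymm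
    · exact Finset.min'_le _ _ (mem_moved.2 hmi)
    · apply Finset.min'_le M
      have : (moved (q i)).min' (moved_nonempty_of_ne_one h) ∈ moved (q i) := Finset.min'_mem _ _
      fin_cases i <;> simp_all
  -- two different permutations cannot both move `m`: their levels would coincide in disjoint sets
  have uniq : ∀ i j, i ≠ j → q i m ≠ m → q j m ≠ m → False := by
    intro i j hij hi hj
    have hi1 : q i ≠ 1 := fun e => hi (by simp [e])
    have hj1 : q j ≠ 1 := fun e => hj (by simp [e])
    have a := hq i hi1
    have b := hq j hj1
    rw [key i hi hi1] at a
    rw [key j hj hj1] at b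
    exact Finset.disjoint_left.1 (hV i j hij) a b
  -- some permutation moves `m`
  have hex : q 0 m ≠ m ∨ q 1 m ≠ m ∨ q 2 m ≠ m := by
    simp only [hM, Finset.mem_union, mem_moved] at hmM
    tauto
  refine ⟨m, ?_⟩
  unfold MovedByOne
  rcases hex with h0 | h1 | h2
  · refine Or.inl ⟨h0, ?_, ?_⟩
    · by_contra h; exact uniq 0 1 (by decide) h0 h
    · by_contra h; exact uniq 0 2 (by decide) h0 h
  · refine Or.inr (Or.inl ⟨?_, h1, ?_⟩)
    · by_contra h; exact uniq 0 1 (by decide) h h1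
    · by_contra h; exact uniq 1 2 (by decide) h1 h
  · refine Or.inr (Or.inr ⟨?_, ?_, h2⟩)
    · by_contra h; exact uniq 0 2 (by decide) h h2
    · by_contra h; exact uniq 1 2 (by decide) h h2

/-- **Ultrametric criterion.**  Level-separated triples are support-separated, hence TPP: the TPP is AUTOMATIC
when the three sets branch on pairwise disjoint sets of levels.  (And then `|S||T||U| ≤ ∏ₓ (n - x) = n!`,
the abelian bound: census § Strengthen S2′.) [folklore] -/
theorem supportSeparated_of_levelSeparated {V : Fin 3 → Finset (Fin n)} {S T U : Finset (Equiv.Perm (Fin n))}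
    (h : LevelSeparated V S T U) : SupportSeparated S T U := by
  obtain ⟨hV, hS, hT, hU⟩ := h
  intro s hs s' hs' t ht t' ht' u hu u' hu' hne
  let q : Fin 3 → Equiv.Perm (Fin n) := ![s * s'⁻¹, t * t'⁻¹, u * u'⁻¹]
  have hq : ∀ i, ∀ h : q i ≠ 1, (moved (q i)).min' (moved_nonempty_of_ne_one h) ∈ V i := by
    intro i h
    fin_cases i
    · exact hS s hs s' hs' h
    · exact hT t ht t' ht' h
    · exact hU u hu u' hu' h
  have hne' : ∃ i, q i ≠ 1 := by
    by_contra hall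
    push Not at hall
    apply hne
    have e0 := hall 0
    have e1 := hall 1
    have e2 := hall 2
    simp only [q, Matrix.cons_val_zero, Matrix.cons_val_one] at e0 e1
    have e2' : u * u'⁻¹ = 1 := e2
    exact ⟨mul_inv_eq_one.1 e0, mul_inv_eq_one.1 e1, mul_inv_eq_one.1 e2'⟩
  obtain ⟨x, hx⟩ := movedByOne_of_levels V hV q hq hne'
  exact ⟨x, hx⟩

theorem tpp_of_levelSeparated {V : Fin 3 → Finset (Fin n)} {S T U : Finset (Equiv.Perm (Fin n))}
    (h : LevelSeparated V S T U) : TripleProductProperty S T U :=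
  tpp_of_supportSeparated (supportSeparated_of_levelSeparated h)

end Level

/-! ## §2 Strengthenings typed for the census -/

/-- **S1′ — approximate-group witnesses.**  `X` with the extra rigidity that the three quotient sets are small:
`|X X⁻¹| ≤ e^{c√n}·|X|` for each set (doubling `e^{o(√n)}`).  The rigidity points to the hosted world
(Freiman–Ruzsa/BGT heuristics: such sets should be commensurable with cosets of window-sized subgroups, all of
which are dead — census T1/T1′), so it buys nothing for this step; recorded as a typed statement only. -/
def SmallDoublingThreshold : Prop :=
  ∀ c : ℝ, 0 < c → ∀ n₀ : ℕ, ∃ n ≥ n₀, ∃ S T U : Finset (Equiv.Perm (Fin n)),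
    TripleProductProperty S T U ∧
    (n.factorial : ℝ) ^ ((3 : ℝ) / 2) * Real.exp (-(c * Real.sqrt (n : ℝ))) < ((S.card * T.card * U.card : ℕ) : ℝ) ∧
    ((S * S⁻¹).card : ℝ) ≤ Real.exp (c * Real.sqrt (n : ℝ)) * S.card ∧
    ((T * T⁻¹).card : ℝ) ≤ Real.exp (c * Real.sqrt (n : ℝ)) * T.card ∧
    ((U * U⁻¹).card : ℝ) ≤ Real.exp (c * Real.sqrt (n : ℝ)) * U.card

theorem thresholdSubsetTriples_of_smallDoubling (h : SmallDoublingThreshold) : ThresholdSubsetTriples := by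
  intro c hc n₀
  obtain ⟨n, hn, S, T, U, hT, hb, -, -, -⟩ := h c hc n₀
  exact ⟨n, hn, S, T, U, hT, hb⟩

/-! ## §3 The hosted negative (for the negative team; conjecture-grade, not claimed) -/

/-- **HostedWindowSubthreshold** (census T1′/N1′): some `c > 0` such that for all large `n`, every TPP triple
`Xᵢ ⊆ Hᵢ` hosted in three subgroups of order at most `√(n!)·e^{c√n}` (the size window of a threshold witness,
Disproof §4b `card_window_of_beats`) has volume `≤ (n!)^{3/2} e^{-c√n}`.  Instances in the tree / census:
`Hᵢ = C(μᵢ)` matching centralisers — the tree theorem `hyperoctahedralSubsets_proof` (2026-08-17, local-triple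
packing + group packing `card_mul_card_le_of_tpp_of_hosted`); `Hᵢ` Young of window size — pair packing through
the cell stabilisers `∏ Sym(cell) ≥ e^{0.54n}` (census v1 T1); `Hᵢ = S_a ≀ S_b`, `a ≥ 3` — below the window or
cell-killed (v1 T1); primitive `Hᵢ` — `|Hᵢ| ≤ 4ⁿ` (Praeger–Saxl), far below the window; mixed hosts
`S_{A} × C(μ)` (|A| ≈ e√n) ARE involution centralisers with `e√n` fixed points, reachable from the tree proof by
forbidding the fixed points in `LocalTriplePackingProof.oneGadget` (census v2 T1′).  The general statement is OPEN;
it is the precise sense in which "every construction line for `X` must be unhosted". -/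
def HostedWindowSubthreshold : Prop :=
  ∃ c : ℝ, 0 < c ∧ ∃ n₀ : ℕ, ∀ n ≥ n₀, ∀ H : Fin 3 → Subgroup (Equiv.Perm (Fin n)),
    (∀ i, (Nat.card (H i) : ℝ) ≤ Real.sqrt (n.factorial : ℝ) * Real.exp (c * Real.sqrt (n : ℝ))) →
    ∀ X : Fin 3 → Finset (Equiv.Perm (Fin n)), (∀ i, ∀ σ ∈ X i, σ ∈ H i) →
      TripleProductProperty (X 0) (X 1) (X 2) →
      (((X 0).card * (X 1).card * (X 2).card : ℕ) : ℝ) ≤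
        (n.factorial : ℝ) ^ ((3 : ℝ) / 2) * Real.exp (-(c * Real.sqrt (n : ℝ)))

end Summit.MatrixMultiplication.MatrixMultiplication.Cruxes.ThresholdSubsetTriples.Strategist2
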